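import Summits.BirchSwinnertonDyer.BirchSwinnertonDyer.Theorems.UniversalToricDescentLocalH1Count
import HarnessLib

/-!
# Route UniversalToricDescent — Greenberg–Vatsal Prop. (2.4), structural half for INFINITE modules:
# `H¹(K_{∞,w}, A) ⥲ H¹(I_v, A)^{Gal(K̄_v/K_{∞,w})}` at a place `v ∤ p` finitely decomposed in `K_∞`

Lead prover bsd-wall-utd-p1 g9 (`--supports stmt-BirchSwinnertonDyer-20399`). Sequel of
`UniversalToricDescentLocalH1Count` (the same statement for FINITE `B`, proved numerically from the
tree's `natCard_one_eq_mul`). For the multiplicative-reduction local term of Greenberg–Vatsal (2.4) the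
module is `A = E[p^∞]` itself (its `Gal(K̄_v/K_{∞,w})`-invariants need not be `p`-divisible, so the
passage to `E[p]` of the good case is not available), and `H¹(K_{∞,w}, E[p^∞]) ≅ ℚ_p/ℤ_p` may be
INFINITE: the numerical five-term sequence does not apply. This file proves the STRUCTURAL statement:

* `exists_resSubgroup_eq_of_forall_conjMap_eq` — for a profinite `G`, a closed normal `N` and a discrete
  `G`-module `M` with `H²(G/N, M^N) = 0`, **every `G`-invariant class of `H¹(N, M)` is a restriction**
  (right exactness of `0 → H¹(G/N, M^N) → H¹(G, M) → H¹(N, M)^{G/N} → H²(G/N, M^N)`; the argument is the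
  one inside the tree's numerical `IsSES.natCard_one_eq_mul`, by dimension shifting through the coinduced
  module, here recorded without any finiteness);
* `resSubgroup_localSubgroup_bijective` — for ANY `ℤ_p`-extension `κ`, `v ∤ p` not split completely in
  `K_∞`, `Hi = Gal(K̄_v/K_{∞,w})`, `I = I_{K_v} ≤ Hi`, and a discrete `p`-primary (pointwise)
  `Γ_{K_v}`-module `A` with continuous action: **`res : H¹(Hi, A) → H¹(I ∩ Hi, A)^{Hi}` is a bijection**
  (`Hi/I` is pro-prime-to-`p`, so `H¹(Hi/I, A^I) = H²(Hi/I, A^I) = 0` by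
  `UniversalToricDescentProPrimeToPVanishing`, which needs only pointwise `p`-power torsion);
* `natCard_pTorsion_subgroupH1_localSubgroup_eq` — hence **`#H¹(Hi, A)[p] = #(H¹(I ∩ Hi, A)^{Hi})[p]`**.

THEOREMS ONLY; no definition, no named fact, no `sorry`. BSD is not advanced by this file.
References: [GreenbergVatsal2000] §2 Prop. (2.4) and proof (p. 22); [GreenbergLNM1716] §3 Lemma 3.3;
[SerreGaloisCohomology1997] I §2.6 (b); [NeukirchSchmidtWingberg2008] (1.6.7).
-/

set_option autoImplicit false
-- `…BirchSwinnertonDyer.BirchSwinnertonDyer.Theorems…` is the problem's mandated namespace (D-0017).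
set_option linter.dupNamespace false

noncomputable section

open scoped Classical

namespace Summit.BirchSwinnertonDyer.BirchSwinnertonDyer.Theorems.UniversalToricDescentLocalH1Transfer

open NumberField IsDedekindDomain Field ValuativeRel
open Literature.NumberTheory.EllipticCurves Literature.NumberTheory.GaloisRepresentations
  IsDedekindDomain.HeightOneSpectrum ContinuousCohomology CategoryTheory
  Summit.BirchSwinnertonDyer.Rank1Residual.Iwasawa.NonsingularTower
  Summit.BirchSwinnertonDyer.Rank1Residual.Iwasawa.NonsplitTower
  Summit.BirchSwinnertonDyer.BirchSwinnertonDyer.Theorems.UniversalToricDescentProPrimeToP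
  Summit.BirchSwinnertonDyer.BirchSwinnertonDyer.Theorems.UniversalToricDescentLocalH1Count

/-! ### §1 Hochschild–Serre, structural: invariant classes are restrictions when `H²(G/N, M^N) = 0` -/

section General

universe u

variable {G : Type u} [Group G] [TopologicalSpace G] [IsTopologicalGroup G] [CompactSpace G]
  [T2Space G] [TotallyDisconnectedSpace G]
variable (N : Subgroup G) [N.Normal] [hN : IsClosed (N : Set G)]
variable {M : Type u} [AddCommGroup M] [TopologicalSpace M] [DiscreteTopology M]
  (ρ : ContinuousRep G ℤ M)

/-- **Right exactness of the five-term sequence.** For a profinite group `G`, a closed normal subgroup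
`N` and a discrete `G`-module `M` with `H²(G/N, M^N) = 0`: every class of `H¹(N, M)` fixed by the
conjugation action of every `a ∈ G` is the restriction of a class of `H¹(G, M)`. (Dimension shifting
through the `G`- and `N`-acyclic coinduced module `C = C(G, M)`, `Q = C/M`: the class is `δ_N q` for a
`G/N`-invariant `q ∈ Q^N` because `H¹(G/N, ker δ_N) ↪ H²(G/N, M^N) = 0`, and `res (δ₀ q) = δ_N q`.)
[cite: SerreGaloisCohomology1997, I §2.6 (b)] [cite: NeukirchSchmidtWingberg2008, (1.6.7)] -/
theorem exists_resSubgroup_eq_of_forall_conjMap_eq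
    [Subsingleton (continuousCohomology 2 (ρ.quotientInvariants N).toTopRep)]
    (y : continuousCohomology 1 (subgroupRep ρ.toTopRep N))
    (hy : ∀ a : G, conjMap ρ.toTopRep N a 1 y = y) :
    ∃ x : continuousCohomology 1 ρ.toTopRep, resSubgroup ρ.toTopRep N 1 x = y := by
  haveI := subsingleton_coind_restrict N ρ 0
  haveI := subsingleton_coind_invariants N ρ 0
  have h := isSES_coind ρ
  haveI := subsingleton_one_imRep N h
  have hXQT := isSES_deltaNHom N h
  have hy' : HOne.of N ρ y ∈ (hOneRep N ρ).toTopRep.ρ.invariants :=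
    (mem_invariants_hOneRep_iff N ρ _).2 hy
  obtain ⟨q, hq, hqy⟩ := (hXQT.δ₀_eq_zero_iff ⟨HOne.of N ρ y, hy'⟩).1 (Subsingleton.elim _ _)
  have hqG : q.1 ∈ ρ.coindQuot.toTopRep.ρ.invariants := fun a ↦ by
    have := congrArg Subtype.val (hq (QuotientGroup.mk a))
    exact this
  refine ⟨h.δ₀ ⟨q.1, hqG⟩, (resSubgroup_δ₀ N h q.1 hqG q.2).trans ?_⟩
  exact ((HOne.of N ρ).symm_apply_apply _).symm.trans (congrArg (HOne.of N ρ).symm hqy)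

end General

/-! ### §2 `H¹(K_{∞,w}, A) ⥲ H¹(I_v, A)^{Gal(K̄_v/K_{∞,w})}` for a `p`-primary discrete `A` -/

section Local

variable {K : Type} [Field K] [NumberField K] {v : HeightOneSpectrum (𝓞 K)} {p : ℕ} [Fact p.Prime]
  (κ : ZpExtension K p)

/-- **Greenberg–Vatsal Prop. (2.4), structural half, infinite modules: `res : H¹(Hi, A) ⥲ H¹(I ∩ Hi, A)^{Hi}`.**
For ANY `ℤ_p`-extension `κ`, a place `v ∤ p` not split completely in `K_∞` (`hns`),
`Hi = Gal(K̄_v/K_{∞,w}) = localSubgroup (ker κ) K_v ⊇ I = I_{K_v}`, and a discrete `Γ_{K_v}`-module `A`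
with continuous action in which every element has `p`-power order (no finiteness: `A = E[p^∞]` is
allowed), restriction of classes is a BIJECTION from `H¹(Hi, A)` onto the classes of `H¹(I ∩ Hi, A)`
fixed by the conjugation action of `Hi`: `Hi/I` is pro-prime-to-`p`
(`coprime_index_of_quotient_localSubgroup_absInertia`), so `H¹(Hi/I, A^I) = H²(Hi/I, A^I) = 0`
(`subsingleton_continuousCohomology_one/two_of_coprime_index`), and the five-term sequence is exact on
both sides (`infOne_exact_resSubgroup`, `exists_resSubgroup_eq_of_forall_conjMap_eq`). The normality of
`absInertia` is an instance argument (supply `absInertia_normal_holds`).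
[cite: GreenbergVatsal2000, §2 Prop. (2.4) and proof (p. 22)] [cite: GreenbergLNM1716, §3 Lemma 3.3]
[cite: SerreGaloisCohomology1997, I §2.6 (b)] -/
theorem resSubgroup_localSubgroup_bijective (hpv : (p : 𝓞 K) ∉ v.asIdeal)
    (hns : ∃ σ : absoluteGaloisGroup (v.adicCompletion K),
      σ ∉ localSubgroup κ.kerSubgroup (v.adicCompletion K))
    {A : Type} [AddCommGroup A] [DistribMulAction (absoluteGaloisGroup (v.adicCompletion K)) A]
    [TopologicalSpace A] [DiscreteTopology A] (hA : ∀ a : A, ∃ k : ℕ, p ^ k • a = 0)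
    (hcont : ∀ a : A, Continuous fun g : absoluteGaloisGroup (v.adicCompletion K) ↦ g • a)
    [hIn : (absInertia (v.adicCompletion K)).Normal] :
    Function.Bijective fun x : Literature.NumberTheory.EllipticCurves.subgroupH1
        (localSubgroup κ.kerSubgroup (v.adicCompletion K)) A ↦
      (⟨resSubgroup (discreteTopRep (localSubgroup κ.kerSubgroup (v.adicCompletion K)) A)
          ((absInertia (v.adicCompletion K)).subgroupOf
            (localSubgroup κ.kerSubgroup (v.adicCompletion K))) 1 x,
        fun h ↦ conjMap_resSubgroup_one _ _ h x⟩ :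
        {y : continuousCohomology 1 (subgroupRep
            (discreteTopRep (localSubgroup κ.kerSubgroup (v.adicCompletion K)) A)
            ((absInertia (v.adicCompletion K)).subgroupOf
              (localSubgroup κ.kerSubgroup (v.adicCompletion K)))) //
          ∀ h : localSubgroup κ.kerSubgroup (v.adicCompletion K),
            conjMap (discreteTopRep (localSubgroup κ.kerSubgroup (v.adicCompletion K)) A)
              ((absInertia (v.adicCompletion K)).subgroupOf
                (localSubgroup κ.kerSubgroup (v.adicCompletion K))) h 1 y = y}) := by
  -- notation
  let G : Type := absoluteGaloisGroup (v.adicCompletion K)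
  let Hi : Subgroup G := localSubgroup κ.kerSubgroup (v.adicCompletion K)
  let I : Subgroup G := absInertia (v.adicCompletion K)
  let N : Subgroup Hi := I.subgroupOf Hi
  haveI : CharZero (v.adicCompletion K) :=
    charZero_of_injective_algebraMap (algebraMap K (v.adicCompletion K)).injective
  haveI := absoluteGaloisGroup_compactSpace (v.adicCompletion K)
  -- topology of `Hi` and `N`
  have hHic : IsClosed (Hi : Set G) :=
    κ.isClosed_kerSubgroup.preimage (map_continuous (resGal (K := K) (v.adicCompletion K)))
  haveI : CompactSpace Hi := isCompact_iff_compactSpace.mp hHic.isCompact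
  have hNc : IsClosed (N : Set Hi) :=
    (isClosed_absInertia_holds (v.adicCompletion K)).preimage continuous_subtype_val
  haveI : IsClosed (N : Set Hi) := hNc
  haveI : TotallyDisconnectedSpace (Hi ⧸ N) :=
    Literature.GroupTheory.ProfiniteSubquotients.totallyDisconnectedSpace_quotient N hNc
  -- `A` as a `ContinuousRep`; the definitional bridge to `discreteTopRep`
  let ρ : ContinuousRep G ℤ A :=
    { toRepresentation := (discreteContRep G A).toRepresentation
      continuous_smul := continuous_prod_of_discrete_right.mpr fun a ↦ hcont a }
  let ρH : ContinuousRep Hi ℤ A :=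
    ρ.restrict (Literature.NumberTheory.GaloisRepresentations.subgroupIncl Hi)
  have hbridge : ρH.toTopRep = discreteTopRep Hi A := rfl
  -- the quotient is pro-prime-to-`p`, so `H¹ = H² = 0` for its `p`-primary module `A^N`
  have hcop : ∀ U : Subgroup (Hi ⧸ N), U.Normal → IsOpen (U : Set (Hi ⧸ N)) → U.index.Coprime p :=
    fun U _ hU ↦ coprime_index_of_quotient_localSubgroup_absInertia κ hpv hns U hU
  have hMN : ∀ m : ρH.invariantsOf N, ∃ k : ℕ, p ^ k • m = 0 := fun m ↦ by
    obtain ⟨k, hk⟩ := hA (m : A)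
    exact ⟨k, Subtype.ext (by
      rw [← Nat.cast_smul_eq_nsmul ℤ, Submodule.coe_smul, Nat.cast_smul_eq_nsmul, hk,
        Submodule.coe_zero])⟩
  haveI : Subsingleton (continuousCohomology 2 (ρH.quotientInvariants N).toTopRep) :=
    subsingleton_continuousCohomology_two_of_coprime_index (ρH.quotientInvariants N) hcop hMN
  haveI : Subsingleton (continuousCohomology 1 (ρH.quotientInvariants N).toTopRep) :=
    subsingleton_continuousCohomology_one_of_coprime_index (ρH.quotientInvariants N) hcop hMN
  -- injectivity of `res` (exactness at `H¹(Hi, A)` and `H¹(Hi/N, A^N) = 0`)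
  have hinj : ∀ x : continuousCohomology 1 ρH.toTopRep, resSubgroup ρH.toTopRep N 1 x = 0 → x = 0 := by
    intro x hx
    obtain ⟨z, hz⟩ := (infOne_exact_resSubgroup N ρH x).1 hx
    rw [Subsingleton.elim z 0, map_zero] at hz
    exact hz.symm
  constructor
  · intro x₁ x₂ h12
    have h' : resSubgroup ρH.toTopRep N 1 x₁ = resSubgroup ρH.toTopRep N 1 x₂ := congrArg Subtype.val h12
    have e1 : resSubgroup ρH.toTopRep N 1 ((x₁ : continuousCohomology 1 ρH.toTopRep) - x₂) =
        resSubgroup ρH.toTopRep N 1 x₁ - resSubgroup ρH.toTopRep N 1 x₂ := map_sub _ _ _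
    have h0 : resSubgroup ρH.toTopRep N 1 ((x₁ : continuousCohomology 1 ρH.toTopRep) - x₂) = 0 := by
      rw [e1, h', sub_self]
    exact sub_eq_zero.mp (hinj _ h0)
  · rintro ⟨y, hy⟩
    obtain ⟨x, hx⟩ := exists_resSubgroup_eq_of_forall_conjMap_eq N ρH y hy
    exact ⟨x, Subtype.ext hx⟩

/-- **`#H¹(Hi, A)[p] = #(H¹(I ∩ Hi, A)^{Hi})[p]`** (`Hi = Gal(K̄_v/K_{∞,w})`, `I = I_{K_v}`, `A` a discrete
`p`-primary `Γ_{K_v}`-module with continuous action, `v ∤ p` not split completely in the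
`ℤ_p`-extension): the bijection `resSubgroup_localSubgroup_bijective` is additive, so it matches the
classes killed by `p` on both sides. This is the shape in which the local term
`#H¹(K_{∞,w}, E[p^∞])[p]` of Greenberg–Vatsal (2.4) is evaluated at a place of multiplicative
reduction (sequel files). [cite: GreenbergVatsal2000, §2 Prop. (2.4) and proof (p. 22)]
[cite: GreenbergLNM1716, §3 Lemma 3.3] -/
theorem natCard_pTorsion_subgroupH1_localSubgroup_eq (hpv : (p : 𝓞 K) ∉ v.asIdeal)
    (hns : ∃ σ : absoluteGaloisGroup (v.adicCompletion K),
      σ ∉ localSubgroup κ.kerSubgroup (v.adicCompletion K))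
    {A : Type} [AddCommGroup A] [DistribMulAction (absoluteGaloisGroup (v.adicCompletion K)) A]
    [TopologicalSpace A] [DiscreteTopology A] (hA : ∀ a : A, ∃ k : ℕ, p ^ k • a = 0)
    (hcont : ∀ a : A, Continuous fun g : absoluteGaloisGroup (v.adicCompletion K) ↦ g • a)
    [hIn : (absInertia (v.adicCompletion K)).Normal] :
    Nat.card {f : Literature.NumberTheory.EllipticCurves.subgroupH1
        (localSubgroup κ.kerSubgroup (v.adicCompletion K)) A // p • f = 0} =
      Nat.card {y : continuousCohomology 1 (subgroupRep
          (discreteTopRep (localSubgroup κ.kerSubgroup (v.adicCompletion K)) A)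
          ((absInertia (v.adicCompletion K)).subgroupOf
            (localSubgroup κ.kerSubgroup (v.adicCompletion K)))) //
        (∀ h : localSubgroup κ.kerSubgroup (v.adicCompletion K),
          conjMap (discreteTopRep (localSubgroup κ.kerSubgroup (v.adicCompletion K)) A)
            ((absInertia (v.adicCompletion K)).subgroupOf
              (localSubgroup κ.kerSubgroup (v.adicCompletion K))) h 1 y = y) ∧ p • y = 0} := by
  -- notation
  let G : Type := absoluteGaloisGroup (v.adicCompletion K)
  let Hi : Subgroup G := localSubgroup κ.kerSubgroup (v.adicCompletion K)
  let I : Subgroup G := absInertia (v.adicCompletion K)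
  let N : Subgroup Hi := I.subgroupOf Hi
  let X : TopRep ℤ Hi := discreteTopRep Hi A
  have hbij := resSubgroup_localSubgroup_bijective κ hpv hns hA hcont
  let r : continuousCohomology 1 X → continuousCohomology 1 (subgroupRep X N) :=
    fun x ↦ resSubgroup X N 1 x
  have hr_inj : Function.Injective r := fun x₁ x₂ h ↦ hbij.1 (Subtype.ext h)
  have hr_nsmul : ∀ (n : ℕ) (x : continuousCohomology 1 X), r (n • x) = n • r x :=
    fun n x ↦ map_nsmul _ n x
  have hr_zero : r 0 = 0 := map_zero _
  have hval : ∀ f : {f : continuousCohomology 1 X // p • f = 0}, p • r f.1 = 0 := fun f ↦ by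
    have hf : p • (f.1 : continuousCohomology 1 X) = 0 := f.2
    rw [← hr_nsmul, hf, hr_zero]
  refine Nat.card_congr (Equiv.ofBijective
    (fun f ↦ ⟨r f.1, fun h ↦ conjMap_resSubgroup_one X N h f.1, hval f⟩) ⟨?_, ?_⟩)
  · rintro ⟨f₁, hf₁⟩ ⟨f₂, hf₂⟩ h12
    exact Subtype.ext (hr_inj (congrArg Subtype.val h12))
  · rintro ⟨y, hy, hpy⟩
    obtain ⟨x, hx⟩ := hbij.2 ⟨y, hy⟩
    have hx' : r x = y := congrArg Subtype.val hx
    refine ⟨⟨x, hr_inj ?_⟩, Subtype.ext hx'⟩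
    rw [hr_nsmul, hx', hpy, hr_zero]

end Local

end Summit.BirchSwinnertonDyer.BirchSwinnertonDyer.Theorems.UniversalToricDescentLocalH1Transfer

end
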